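/-
Literature/Probability/FitznerVanDerHofstad2017/WbxCellKernel.lean   (NEW, additive, d-generic)

The right-hand side of the all-kernel reading of the `WBX(M)` cell
(`NbwCountKernel.toReal_tsum_sq_weighted_repBubble_le_liveListNbwAtomsUniformK`) as ONE exact rational
`wbxCellQ d m M L z g₁ I`, order by order `wbxOrderQ`, class chunk by class chunk `wbxClassesQ` — kernel-evaluable
at fixed dimension and rational data, over the fast rows of `SrwCountEgfKernel`.
-/
import Literature.Probability.FitznerVanDerHofstad2017.SrwCountEgfKernel
import HarnessLib

/-!
# The rational evaluator of the `WBX(M)` cell (all-kernel reading)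

`LiveEndpointClasses.toReal_tsum_sq_weighted_repBubble_le_liveListAtomsCanon` bounds the squared-weight
repulsive bubble `Σ'_y ‖y‖₂² P_p(0 ⟷_{≥m} y ∘ y ⟷ 0)` by a finite sum over orders `m ≤ i ≤ M` and live classes
`l ∈ liveList d i` of explicit terms ([NoBLE17-I] §5.3.3, class by class) with walk-count atoms as hypotheses, plus
the tail `(2dz)^{M+1} Γ₂ c_k`; `NbwCountKernel` discharges the atoms by the non-backtracking majorant and the
far-node factor by the `x`-uniform cap `K_{1,2J}(x) ≤ I_{1,2J}(0)` ((5.14)/(5.26)).  This module turns the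
resulting right-hand side, at RATIONAL data — `z ≥ p`, majorants `γ_i ≥ f_i(p)` of the diagrammatic constants,
even cuts `L_i = 2J_i ≥ i` (one per order, constant for the one-rational cell form) and `I_i ≥ I_{1,2J_i}(0; d)` —
into kernel arithmetic:

* `wbxClassQ d i L l z g₁ I` — one class: `#class · b_i · (‖·‖₂² · (Σ_{r<L} z^r b_r + (2dz)^L ρ_d g₁ I))`,
  `ρ_d = (2d−2)/(2d−1)`; the inner sum through the class-independent weights `w_j = Σ_{r<L} z^r [P_r]_j`
  (`nbwWeights`, `nbwInnerQ`, identity `nbwInnerQ_srwCountRowFast`: `Σ_r z^r b_r = Σ_j w_j c_j`), so a class costs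
  ONE fast SRW row `srwCountRowFast d L (canonMagnitudes l)` and two dot products;
* `wbxClassesQ … ls` (a chunk of classes; additive, `wbxClassesQ_append`), `wbxOrderQ d i L …` (the live list of
  order `i`; `wbxOrderQ_eq_take_add_drop`), `wbxCellQ d m M L …` (the cell);
* `toReal_tsum_sq_weighted_repBubble_le_sum_wbxOrderQ` / `…_le_wbxCellQ`: the bubble is at most
  `Σ_{i=m}^{M} z^i · wbxOrderQ d i (2J_i) z γ₁ I_i + (2dz)^{M+1} γ₂ c_k` (`= wbxCellQ … + tail` at a constant cut);
* `wbxOrderPolicyQ d i J z g₁ I` / `wbxClassesPolicyQ` (+ `_eq_take_add_drop`): the order with a CUT POLICY — even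
  cut `2·J l` and far-node rational `I l` chosen class by class (e.g. the per-class optimal cut) — at the kernel
  cost of a constant cut thanks to `strictAppQ` (the cut is reduced to a numeral before the class term is
  instantiated, so the per-cut tables are shared); theorems `…_le_sum_wbxOrderPolicyQ`, `…_le_policyBounds`;
* `toReal_tsum_sq_weighted_repBubble_le_orderBounds`: the same with rational per-order bounds
  `q_i ≥ wbxOrderQ d i …`, each of which a fixed-dimension consumer decides by `decide +kernel` in its own
  declaration.  TIMING NOTE (kernel-cost census only, no statement about percolation in any dimension;
  build farm, `d = 10`, `L = 22`): about `0.07 s` of kernel time per live class — order `12` ≈ `13 s`,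
  order `16` (`497` classes, the largest of the `i ≤ 16` cell) ≈ `35 s` as ONE decide under
  `set_option maxHeartbeats 0 in`; the whole `4 ≤ i ≤ 16` cell is a couple of kernel-minutes over thirteen
  declarations.  A much larger single evaluation is ended by the checker's memory cap with the generic
  "did not reduce to isTrue" message (not a heartbeat limit): chunk it (`wbxOrderQ_eq_take_add_drop`,
  `wbxClassesQ_eq_take_add_drop`).

Pointer language: input-certification forms at rational data; every statement is `d`-generic; no numeral of
any record enters and nothing is asserted about any dimension.

References: [NoBLE17-I] = `FitznerVanDerHofstad2016NoBLE` (§5.3.1 (5.36)–(5.38), §5.3.3 p. 1098, (5.14)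
p. 1092, (5.26) p. 1094); [FvdH17] = `FitznerVanDerHofstad2017` (§4.2 (4.18)); [MS93] = `MadrasSlade1993`
(Cor. 5.3.2 (5.3.3), reprint PDF p. 148).
-/

namespace Literature.Probability.FitznerVanDerHofstad2017

open _root_.MeasureTheory Finset
open Literature.Barriers.CriticalPhenomena Literature.Probability.Percolation
open Literature.Probability.LatticeModels
open SrwCount (sum_map_range getD_map_range srwCount)
open scoped BigOperators ENNReal

variable {d : ℕ}

/-! ### §1. The evaluator -/

/-- **Class-independent inner weights** `w_j = Σ_{r<L} z^r [P_r]_j` (`j < L`; `[P_r]_j` = the coefficient lists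
`nbwPolyCoef` of `NbwCountKernel`, [MS93] (5.3.3)): `Σ_{r<L} z^r b_r(x) = Σ_j w_j c_j(x)`, so the inner node of a
class costs ONE dot product with the SRW row instead of a whole NBW row — and the kernel evaluates the weight list
once per `decide` (it is the same closed term for every class).
[cite: MadrasSlade1993, Cor. 5.3.2 (5.3.3) (reprint PDF p. 148)] -/
def nbwWeights (d L : ℕ) (z : ℚ) : List ℚ :=
  (List.range L).map fun j => ((List.range L).map fun r => z ^ r * ((nbwPolyCoef d r).getD j 0 : ℚ)).sum

/-- The inner node `Σ_{j<L} w_j · row_j` of an SRW row. [cite: MadrasSlade1993, Cor. 5.3.2 (5.3.3) (reprint PDF p. 148)] -/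
def nbwInnerQ (d L : ℕ) (z : ℚ) (row : List ℕ) : ℚ :=
  ((List.range L).map fun j => (nbwWeights d L z).getD j 0 * (row.getD j 0 : ℚ)).sum

/-- **The weight identity** on the fast row of a live class (`Σ l ≤ d`):
`nbwInnerQ d L z (srwCountRowFast d L (canonMagnitudes l)) = Σ_{r<L} z^r · b_r(canonSite d l)`.
[cite: MadrasSlade1993, Cor. 5.3.2 (5.3.3) (reprint PDF p. 148)] -/
theorem nbwInnerQ_srwCountRowFast {L : ℕ} {l : List ℕ} (hl : l.sum ≤ d) (z : ℚ) :
    nbwInnerQ d L z (srwCountRowFast d L (canonMagnitudes l)) = ∑ r ∈ range L, z ^ r * (nbwAtomFast d L l r : ℚ) := by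
  have hatom : ∀ r ∈ range L, (nbwAtomFast d L l r : ℚ) =
      ∑ j ∈ range L, ((nbwPolyCoef d r).getD j 0 : ℚ) * (srwCount d j (canonSite d l) : ℚ) := by
    intro r hr
    have hrL := mem_range.1 hr
    rw [nbwAtomFast_eq_card hl hrL.le, card_nbwWordsTo_eq_nbwEval, nbwEval, length_nbwPolyCoef, Int.cast_sum,
      ← sum_subset (range_subset_range.2 (show r + 1 ≤ L by omega))]
    · push_cast
      rfl
    · intro j _ hj
      rw [List.getD_eq_default _ _ (by rw [length_nbwPolyCoef]; have := mem_range.not.1 hj; omega)]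
      simp
  have hw : ∀ j ∈ range L, (nbwWeights d L z).getD j 0 = ∑ r ∈ range L, z ^ r * ((nbwPolyCoef d r).getD j 0 : ℚ) :=
    fun j hj => by rw [nbwWeights, getD_map_range _ (mem_range.1 hj) _, sum_map_range]
  have hc : ∀ j ∈ range L, ((srwCountRowFast d L (canonMagnitudes l)).getD j 0 : ℚ) =
      (srwCount d j (canonSite d l) : ℚ) :=
    fun j hj => by rw [srwCountRowFast_canonMagnitudes_getD hl (mem_range.1 hj).le]
  unfold nbwInnerQ
  rw [sum_map_range, sum_congr rfl fun j hj => by rw [hw j hj, hc j hj, sum_mul], sum_comm]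
  refine sum_congr rfl fun r hr => ?_
  rw [hatom r hr, mul_sum]
  exact sum_congr rfl fun j _ => by ring

/-- **One live class** `l` of order `i` at the constant cut `L` (`i ≤ L`), all-kernel reading, rational data
`z ≥ p`, `g₁ ≥ f₁(p)`, `I ≥ I_{1,L}(0; d)`:
`#class(l) · b_i · (‖·‖₂² · (Σ_{r<L} z^r b_r + (2dz)^L · ρ_d g₁ · I))`, `ρ_d = (2d−2)/(2d−1)`; `b_i` and the inner
sum `Σ_r z^r b_r = Σ_j w_j c_j` are both read off ONE fast SRW row `srwCountRowFast d L (canonMagnitudes l)` (the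
kernel shares it), the weights `nbwWeights d L z` once per evaluation.
[cite: FitznerVanDerHofstad2016NoBLE, §5.3.3 p. 1098 (the explicit terms, class by class); §5.3.1 (5.36)–(5.38)]
[cite: FitznerVanDerHofstad2017, §4.2 (4.18)] -/
def wbxClassQ (d i L : ℕ) (l : List ℕ) (z g₁ I : ℚ) : ℚ :=
  ((2 ^ l.sum * d.descFactorial l.sum / (l.map Nat.factorial).prod : ℕ) : ℚ) *
    ((nbwAtomFast d L l i : ℚ) * ((sqwsum 1 l : ℚ) *
      (nbwInnerQ d L z (srwCountRowFast d L (canonMagnitudes l)) +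
        (2 * d * z) ^ L * ((2 * d - 2) / (2 * d - 1) * g₁) * I)))

/-- The sum of the class terms over an explicit list of classes (the unit a consumer decides chunk by chunk).
[cite: FitznerVanDerHofstad2016NoBLE, §5.3.3 p. 1098] -/
def wbxClassesQ (d i L : ℕ) (z g₁ I : ℚ) (ls : List (List ℕ)) : ℚ :=
  (ls.map fun l => wbxClassQ d i L l z g₁ I).sum

/-- **One order** `i`: the class terms summed over `liveList d i`.
[cite: FitznerVanDerHofstad2016NoBLE, §5.3.3 p. 1098] -/
def wbxOrderQ (d i L : ℕ) (z g₁ I : ℚ) : ℚ := wbxClassesQ d i L z g₁ I (liveList d i)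

/-- **The `WBX(M)` cell evaluator** `Σ_{i=m}^{M} z^i · wbxOrderQ d i L z g₁ I` — one exact rational,
kernel-evaluable at fixed `d, m, M, L` and rational data (`decide +kernel`).  TIMING NOTE (kernel-cost census
only, no statement about percolation in any dimension; build farm, `d = 10`, `L = 22`): about `0.07 s` of
kernel time per live class (order `12` ≈ `13 s`, order `16` = `497` classes ≈ `35 s`, each as ONE
`decide +kernel` under `set_option maxHeartbeats 0 in`); the checker's MEMORY cap — not a heartbeat limit —
ends a much larger single evaluation with the generic "did not reduce to isTrue" message, so decide a
table-range cell ORDER BY ORDER (`toReal_tsum_sq_weighted_repBubble_le_orderBounds`) and, if ever needed, an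
order chunk by chunk (`wbxOrderQ_eq_take_add_drop`, `wbxClassesQ_eq_take_add_drop`).
[cite: FitznerVanDerHofstad2016NoBLE, §5.3.3 p. 1098; §5.3.1 (5.36)–(5.38)]
[cite: FitznerVanDerHofstad2017, §4.2 (4.18)] -/
def wbxCellQ (d m M L : ℕ) (z g₁ I : ℚ) : ℚ :=
  ((List.range (M + 1 - m)).map fun j => z ^ (m + j) * wbxOrderQ d (m + j) L z g₁ I).sum

/-- Strict application of a cut-indexed quantity: `strictAppQ f n = f n`, but the kernel first reduces `n` to a
numeral (recursor on a literal) and instantiates `f` at the closed successor term, so that a cut given by a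
FUNCTION of the class is shared across classes exactly like a literal cut (measured: per-class policy at the cost
of the constant cut; the naive `f (2 * J l)` is not shared and does not finish). [folklore] -/
private def strictAppQ (f : ℕ → ℚ) (n : ℕ) : ℚ := Nat.rec (motive := fun _ => ℚ) (f 0) (fun m _ => f (m + 1)) n

/-- `strictAppQ f n = f n`. [folklore] -/
private theorem strictAppQ_eq (f : ℕ → ℚ) (n : ℕ) : strictAppQ f n = f n := by
  cases n <;> rfl

/-- A chunk of classes of order `i` under a per-class CUT POLICY `J` (even cuts `2·J l`) and per-class far-node
rationals `I l`. [cite: FitznerVanDerHofstad2016NoBLE, §5.3.3 p. 1098; (5.14) p. 1092, (5.26) p. 1094] -/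
def wbxClassesPolicyQ (d i : ℕ) (J : List ℕ → ℕ) (z g₁ : ℚ) (I : List ℕ → ℚ) (ls : List (List ℕ)) : ℚ :=
  (ls.map fun l => strictAppQ (fun L => wbxClassQ d i L l z g₁ (I l)) (2 * J l)).sum

/-- **One order under a cut policy**: `Σ_{l ∈ liveList d i}` of the class terms at the class's own even cut
`2·J l` and far-node rational `I l`. [cite: FitznerVanDerHofstad2016NoBLE, §5.3.3 p. 1098; (5.14) p. 1092, (5.26) p. 1094] -/
def wbxOrderPolicyQ (d i : ℕ) (J : List ℕ → ℕ) (z g₁ : ℚ) (I : List ℕ → ℚ) : ℚ :=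
  wbxClassesPolicyQ d i J z g₁ I (liveList d i)

/-- Chunking under a policy. [cite: FitznerVanDerHofstad2016NoBLE, §5.3.3 p. 1098] -/
theorem wbxClassesPolicyQ_eq_take_add_drop (d i : ℕ) (J : List ℕ → ℕ) (z g₁ : ℚ) (I : List ℕ → ℚ)
    (ls : List (List ℕ)) (n : ℕ) :
    wbxClassesPolicyQ d i J z g₁ I ls =
      wbxClassesPolicyQ d i J z g₁ I (ls.take n) + wbxClassesPolicyQ d i J z g₁ I (ls.drop n) := by
  rw [wbxClassesPolicyQ, wbxClassesPolicyQ, wbxClassesPolicyQ, ← List.sum_append, ← List.map_append,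
    List.take_append_drop]

/-- Chunking an order under a policy at position `n` of its live list. [cite: FitznerVanDerHofstad2016NoBLE, §5.3.3 p. 1098] -/
theorem wbxOrderPolicyQ_eq_take_add_drop (d i : ℕ) (J : List ℕ → ℕ) (z g₁ : ℚ) (I : List ℕ → ℚ) (n : ℕ) :
    wbxOrderPolicyQ d i J z g₁ I = wbxClassesPolicyQ d i J z g₁ I ((liveList d i).take n) +
      wbxClassesPolicyQ d i J z g₁ I ((liveList d i).drop n) :=
  wbxClassesPolicyQ_eq_take_add_drop d i J z g₁ I (liveList d i) n

/-- Chunking: `wbxClassesQ` is additive in the class list. [cite: FitznerVanDerHofstad2016NoBLE, §5.3.3 p. 1098] -/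
theorem wbxClassesQ_append (d i L : ℕ) (z g₁ I : ℚ) (ls ls' : List (List ℕ)) :
    wbxClassesQ d i L z g₁ I (ls ++ ls') = wbxClassesQ d i L z g₁ I ls + wbxClassesQ d i L z g₁ I ls' := by
  rw [wbxClassesQ, wbxClassesQ, wbxClassesQ, List.map_append, List.sum_append]

/-- Chunking a class list at position `n` (nest it: `(ls.drop n).take n'`, …) — one `decide +kernel` per chunk keeps
every kernel evaluation inside the checker's memory budget however large the order.
[cite: FitznerVanDerHofstad2016NoBLE, §5.3.3 p. 1098] -/
theorem wbxClassesQ_eq_take_add_drop (d i L : ℕ) (z g₁ I : ℚ) (ls : List (List ℕ)) (n : ℕ) :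
    wbxClassesQ d i L z g₁ I ls = wbxClassesQ d i L z g₁ I (ls.take n) + wbxClassesQ d i L z g₁ I (ls.drop n) := by
  rw [← wbxClassesQ_append, List.take_append_drop]

/-- Chunking an order at position `n` of its live list. [cite: FitznerVanDerHofstad2016NoBLE, §5.3.3 p. 1098] -/
theorem wbxOrderQ_eq_take_add_drop (d i L : ℕ) (z g₁ I : ℚ) (n : ℕ) :
    wbxOrderQ d i L z g₁ I =
      wbxClassesQ d i L z g₁ I ((liveList d i).take n) + wbxClassesQ d i L z g₁ I ((liveList d i).drop n) :=
  wbxClassesQ_eq_take_add_drop d i L z g₁ I (liveList d i) n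

/-! ### §2. The evaluator is the right-hand side of the all-kernel cell -/

/-- Cast of one class term to the shape of `NbwCountKernel.toReal_tsum_sq_weighted_repBubble_le_liveListNbwAtomsUniformK`
(atoms `nbwAtom`), for a live class `l ∈ liveList d i` and `i ≤ L`. [folklore] -/
private theorem cast_wbxClassQ {i L : ℕ} {l : List ℕ} (hl : l ∈ liveList d i) (hi : i ≤ L) (z g₁ I : ℚ) :
    ((wbxClassQ d i L l z g₁ I : ℚ) : ℝ) =
      ((2 ^ l.sum * d.descFactorial l.sum / (l.map Nat.factorial).prod : ℕ) : ℝ) *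
        ((nbwAtom d i l i : ℝ) * ((sqwsum 1 l : ℝ) *
          ((∑ r ∈ range L, (z : ℝ) ^ r * (nbwAtom d L l r : ℝ)) +
            (2 * d * (z : ℝ)) ^ L * ((2 * d - 2) / (2 * d - 1) * (g₁ : ℝ)) * (I : ℝ)))) := by
  have hsum : l.sum ≤ d := (mem_liveList.1 hl).2.2.1
  rw [wbxClassQ, nbwInnerQ_srwCountRowFast hsum, nbwAtomFast_eq_nbwAtom hsum hi le_rfl]
  push_cast
  congr 4
  refine sum_congr rfl fun r hr => ?_
  rw [nbwAtomFast_eq_nbwAtom hsum (mem_range.1 hr).le (mem_range.1 hr).le]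

/-- Cast of one order. [folklore] -/
private theorem cast_wbxOrderQ {i L : ℕ} (hi : i ≤ L) (z g₁ I : ℚ) :
    ((wbxOrderQ d i L z g₁ I : ℚ) : ℝ) =
      ((liveList d i).map fun l =>
        ((2 ^ l.sum * d.descFactorial l.sum / (l.map Nat.factorial).prod : ℕ) : ℝ) *
          ((nbwAtom d i l i : ℝ) * ((sqwsum 1 l : ℝ) *
            ((∑ r ∈ range L, (z : ℝ) ^ r * (nbwAtom d L l r : ℝ)) +
              (2 * d * (z : ℝ)) ^ L * ((2 * d - 2) / (2 * d - 1) * (g₁ : ℝ)) * (I : ℝ))))).sum := by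
  rw [wbxOrderQ, wbxClassesQ, Rat.cast_list_sum, List.map_map]
  exact congrArg List.sum (List.map_congr_left fun l hl => cast_wbxClassQ hl hi z g₁ I)

/-- Cast of one order under a cut policy. [folklore] -/
private theorem cast_wbxOrderPolicyQ {i : ℕ} {J : List ℕ → ℕ} (hJ : ∀ l ∈ liveList d i, i ≤ 2 * J l) (z g₁ : ℚ)
    (I : List ℕ → ℚ) :
    ((wbxOrderPolicyQ d i J z g₁ I : ℚ) : ℝ) =
      ((liveList d i).map fun l =>
        ((2 ^ l.sum * d.descFactorial l.sum / (l.map Nat.factorial).prod : ℕ) : ℝ) *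
          ((nbwAtom d i l i : ℝ) * ((sqwsum 1 l : ℝ) *
            ((∑ r ∈ range (2 * J l), (z : ℝ) ^ r * (nbwAtom d (2 * J l) l r : ℝ)) +
              (2 * d * (z : ℝ)) ^ (2 * J l) * ((2 * d - 2) / (2 * d - 1) * (g₁ : ℝ)) * (I l : ℝ))))).sum := by
  rw [wbxOrderPolicyQ, wbxClassesPolicyQ, Rat.cast_list_sum, List.map_map]
  exact congrArg List.sum (List.map_congr_left fun l hl => by
    rw [Function.comp_apply, strictAppQ_eq, cast_wbxClassQ hl (hJ l hl)])

/-- Cast of the cell: `wbxCellQ = Σ_{i ∈ [m, M]} z^i · wbxOrderQ i`. [folklore] -/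
private theorem cast_wbxCellQ (d m M L : ℕ) (z g₁ I : ℚ) :
    ((wbxCellQ d m M L z g₁ I : ℚ) : ℝ) = ∑ i ∈ Icc m M, (z : ℝ) ^ i * (wbxOrderQ d i L z g₁ I : ℝ) := by
  have hIcc : Icc m M = Ico m (M + 1) := by
    ext i
    simp
  rw [wbxCellQ, sum_map_range, Rat.cast_sum, hIcc, Finset.sum_Ico_eq_sum_range]
  refine sum_congr rfl fun j _ => ?_
  push_cast
  rfl

/-- **The `WBX(M)` cell at the all-kernel reading, order by order, with a cut per order**: for rational
`z ≥ p`, rational majorants `γ` of the diagrammatic constants, even cuts `2·J i ≥ i` and rationals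
`I i ≥ I_{1,2J_i}(0; d)` (`m ≤ i ≤ M`),
`Σ'_y ‖y‖₂² P_p(0 ⟷_{≥m} y ∘ y ⟷ 0) ≤ Σ_{i=m}^{M} z^i · wbxOrderQ d i (2J_i) z γ₁ I_i + (2dz)^{M+1} γ₂ c_k`.
Pointer language: an input-certification form, no statement about any dimension.
[cite: FitznerVanDerHofstad2016NoBLE, §5.3.1 (5.36)–(5.38) with §5.3.3 p. 1098; (5.14) p. 1092, (5.26) p. 1094]
[cite: FitznerVanDerHofstad2017, §4.2 (4.18)]
[cite: MadrasSlade1993, Cor. 5.3.2 (5.3.3) (reprint PDF p. 148)] -/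
theorem toReal_tsum_sq_weighted_repBubble_le_sum_wbxOrderQ {ι : Type*} [Fintype ι] [Nonempty ι]
    (hd : 3 ≤ d) {p : unitInterval} (hp : p ∈ Set.Ioo (nbwThresholdI d) (criticalProbI d)) (m M : ℕ)
    {J : ℕ → ℕ} (hJ : ∀ i ∈ Icc m M, i ≤ 2 * J i) {𝒮 : ι → ℕ × ℕ × Set (Site d)} {cμ : ℝ} {c : ι → ℝ}
    (hc : ∀ k, 0 < c k) {γ : Fin 3 → ℚ} (hΓ : ∀ i, nobleFOf 𝒮 cμ c i p ≤ (γ i : ℝ)) {k : ι}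
    (hk : 𝒮 k = (1, M + 1, {(0 : Site d)})) {z : ℚ} (hpz : (p : ℝ) ≤ (z : ℝ)) {I : ℕ → ℚ}
    (hI : ∀ i ∈ Icc m M, srwI d 1 (2 * J i) 0 ≤ (I i : ℝ)) :
    (∑' y : Site d, ENNReal.ofReal (euclidNorm y ^ 2) *
        bondPercolation (zdGraph d) p (openConnGe m (0 : Site d) y □ openConn y 0)).toReal ≤
      (∑ i ∈ Icc m M, (z : ℝ) ^ i * (wbxOrderQ d i (2 * J i) z (γ 1) (I i) : ℝ)) +
        (2 * d * (z : ℝ)) ^ (M + 1) * ((γ 2 : ℝ) * c k) := by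
  have h := toReal_tsum_sq_weighted_repBubble_le_liveListNbwAtomsUniformK hd hp m M hc (Γ := fun i => (γ i : ℝ))
    hΓ hk (fun i _ => J i) hpz (Ibar := fun i _ => (I i : ℝ)) fun i hi _ _ => hI i hi
  refine h.trans (le_of_eq ?_)
  congr 1
  refine sum_congr rfl fun i hi => ?_
  rw [cast_wbxOrderQ (hJ i hi)]

/-- **The `WBX(M)` cell as ONE kernel-evaluable rational** (constant even cut `L = 2J ≥ M`, one rational
`I ≥ I_{1,2J}(0; d)`): `Σ'_y ‖y‖₂² P_p(0 ⟷_{≥m} y ∘ y ⟷ 0) ≤ wbxCellQ d m M (2J) z γ₁ I + (2dz)^{M+1} γ₂ c_k`.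
[cite: FitznerVanDerHofstad2016NoBLE, §5.3.1 (5.36)–(5.38) with §5.3.3 p. 1098; (5.14) p. 1092, (5.26) p. 1094]
[cite: FitznerVanDerHofstad2017, §4.2 (4.18)]
[cite: MadrasSlade1993, Cor. 5.3.2 (5.3.3) (reprint PDF p. 148)] -/
theorem toReal_tsum_sq_weighted_repBubble_le_wbxCellQ {ι : Type*} [Fintype ι] [Nonempty ι]
    (hd : 3 ≤ d) {p : unitInterval} (hp : p ∈ Set.Ioo (nbwThresholdI d) (criticalProbI d)) (m M J : ℕ)
    (hM : M ≤ 2 * J) {𝒮 : ι → ℕ × ℕ × Set (Site d)} {cμ : ℝ} {c : ι → ℝ} (hc : ∀ k, 0 < c k) {γ : Fin 3 → ℚ}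
    (hΓ : ∀ i, nobleFOf 𝒮 cμ c i p ≤ (γ i : ℝ)) {k : ι} (hk : 𝒮 k = (1, M + 1, {(0 : Site d)}))
    {z : ℚ} (hpz : (p : ℝ) ≤ (z : ℝ)) {I : ℚ} (hI : srwI d 1 (2 * J) 0 ≤ (I : ℝ)) :
    (∑' y : Site d, ENNReal.ofReal (euclidNorm y ^ 2) *
        bondPercolation (zdGraph d) p (openConnGe m (0 : Site d) y □ openConn y 0)).toReal ≤
      (wbxCellQ d m M (2 * J) z (γ 1) I : ℝ) + (2 * d * (z : ℝ)) ^ (M + 1) * ((γ 2 : ℝ) * c k) := by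
  rw [cast_wbxCellQ]
  exact toReal_tsum_sq_weighted_repBubble_le_sum_wbxOrderQ hd hp m M (J := fun _ => J)
    (fun i hi => (mem_Icc.1 hi).2.trans hM) hc hΓ hk hpz (I := fun _ => I) fun _ _ => hI

/-- **Order-by-order kernel certificates**: if rational numbers `q i` dominate the order evaluators,
`wbxOrderQ d i (2J_i) z γ₁ I_i ≤ q i` for `m ≤ i ≤ M` (each a separate `decide +kernel`, chunked further by
`wbxOrderQ_eq_take_add_drop`), then `Σ'_y ‖y‖₂² P_p(…) ≤ Σ_{i=m}^{M} z^i q_i + (2dz)^{M+1} γ₂ c_k`.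
[cite: FitznerVanDerHofstad2016NoBLE, §5.3.1 (5.36)–(5.38) with §5.3.3 p. 1098; (5.14) p. 1092, (5.26) p. 1094]
[cite: FitznerVanDerHofstad2017, §4.2 (4.18)] -/
theorem toReal_tsum_sq_weighted_repBubble_le_orderBounds {ι : Type*} [Fintype ι] [Nonempty ι]
    (hd : 3 ≤ d) {p : unitInterval} (hp : p ∈ Set.Ioo (nbwThresholdI d) (criticalProbI d)) (m M : ℕ)
    {J : ℕ → ℕ} (hJ : ∀ i ∈ Icc m M, i ≤ 2 * J i) {𝒮 : ι → ℕ × ℕ × Set (Site d)} {cμ : ℝ} {c : ι → ℝ}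
    (hc : ∀ k, 0 < c k) {γ : Fin 3 → ℚ} (hΓ : ∀ i, nobleFOf 𝒮 cμ c i p ≤ (γ i : ℝ)) {k : ι}
    (hk : 𝒮 k = (1, M + 1, {(0 : Site d)})) {z : ℚ} (hpz : (p : ℝ) ≤ (z : ℝ)) {I : ℕ → ℚ}
    (hI : ∀ i ∈ Icc m M, srwI d 1 (2 * J i) 0 ≤ (I i : ℝ))
    {q : ℕ → ℚ} (hq : ∀ i ∈ Icc m M, wbxOrderQ d i (2 * J i) z (γ 1) (I i) ≤ q i) :
    (∑' y : Site d, ENNReal.ofReal (euclidNorm y ^ 2) *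
        bondPercolation (zdGraph d) p (openConnGe m (0 : Site d) y □ openConn y 0)).toReal ≤
      (∑ i ∈ Icc m M, (z : ℝ) ^ i * (q i : ℝ)) + (2 * d * (z : ℝ)) ^ (M + 1) * ((γ 2 : ℝ) * c k) := by
  have hz : (0 : ℝ) ≤ z := le_trans (by exact_mod_cast unitInterval.nonneg p) hpz
  refine (toReal_tsum_sq_weighted_repBubble_le_sum_wbxOrderQ hd hp m M hJ hc hΓ hk hpz hI).trans ?_
  gcongr with i hi
  exact hq i hi

/-- **The `WBX(M)` cell at the all-kernel reading with a CUT POLICY per class**: even cuts `2·J_i(l) ≥ i` and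
rationals `I_i(l) ≥ I_{1,2J_i(l)}(0; d)` chosen class by class (e.g. the per-class optimal cut), rational `z ≥ p`,
`γ ≥ f(p)`: `Σ'_y ‖y‖₂² P_p(0 ⟷_{≥m} y ∘ y ⟷ 0) ≤ Σ_{i=m}^{M} z^i · wbxOrderPolicyQ d i J_i z γ₁ I_i + (2dz)^{M+1} γ₂ c_k`.
Kernel cost = that of the constant cut (`strictAppQ`).  Pointer language: an input-certification form.
[cite: FitznerVanDerHofstad2016NoBLE, §5.3.1 (5.36)–(5.38) with §5.3.3 p. 1098; (5.14) p. 1092, (5.26) p. 1094]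
[cite: FitznerVanDerHofstad2017, §4.2 (4.18)]
[cite: MadrasSlade1993, Cor. 5.3.2 (5.3.3) (reprint PDF p. 148)] -/
theorem toReal_tsum_sq_weighted_repBubble_le_sum_wbxOrderPolicyQ {ι : Type*} [Fintype ι] [Nonempty ι]
    (hd : 3 ≤ d) {p : unitInterval} (hp : p ∈ Set.Ioo (nbwThresholdI d) (criticalProbI d)) (m M : ℕ)
    {J : ℕ → List ℕ → ℕ} (hJ : ∀ i ∈ Icc m M, ∀ l ∈ liveList d i, i ≤ 2 * J i l)
    {𝒮 : ι → ℕ × ℕ × Set (Site d)} {cμ : ℝ} {c : ι → ℝ} (hc : ∀ k, 0 < c k) {γ : Fin 3 → ℚ}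
    (hΓ : ∀ i, nobleFOf 𝒮 cμ c i p ≤ (γ i : ℝ)) {k : ι} (hk : 𝒮 k = (1, M + 1, {(0 : Site d)}))
    {z : ℚ} (hpz : (p : ℝ) ≤ (z : ℝ)) {I : ℕ → List ℕ → ℚ}
    (hI : ∀ i ∈ Icc m M, ∀ l ∈ liveList d i, srwI d 1 (2 * J i l) 0 ≤ (I i l : ℝ)) :
    (∑' y : Site d, ENNReal.ofReal (euclidNorm y ^ 2) *
        bondPercolation (zdGraph d) p (openConnGe m (0 : Site d) y □ openConn y 0)).toReal ≤
      (∑ i ∈ Icc m M, (z : ℝ) ^ i * (wbxOrderPolicyQ d i (J i) z (γ 1) (I i) : ℝ)) +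
        (2 * d * (z : ℝ)) ^ (M + 1) * ((γ 2 : ℝ) * c k) := by
  have h := toReal_tsum_sq_weighted_repBubble_le_liveListNbwAtomsUniformK hd hp m M hc (Γ := fun i => (γ i : ℝ))
    hΓ hk J hpz (Ibar := fun i l => (I i l : ℝ)) hI
  refine h.trans (le_of_eq ?_)
  congr 1
  refine sum_congr rfl fun i hi => ?_
  rw [cast_wbxOrderPolicyQ (hJ i hi)]

/-- **Order-by-order kernel certificates under a cut policy**: rational `q i ≥ wbxOrderPolicyQ d i J_i z γ₁ I_i`
(`m ≤ i ≤ M`, each its own `decide +kernel`) give `Σ'_y ‖y‖₂² P_p(…) ≤ Σ_{i=m}^{M} z^i q_i + (2dz)^{M+1} γ₂ c_k`.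
[cite: FitznerVanDerHofstad2016NoBLE, §5.3.1 (5.36)–(5.38) with §5.3.3 p. 1098; (5.14) p. 1092, (5.26) p. 1094]
[cite: FitznerVanDerHofstad2017, §4.2 (4.18)] -/
theorem toReal_tsum_sq_weighted_repBubble_le_policyBounds {ι : Type*} [Fintype ι] [Nonempty ι]
    (hd : 3 ≤ d) {p : unitInterval} (hp : p ∈ Set.Ioo (nbwThresholdI d) (criticalProbI d)) (m M : ℕ)
    {J : ℕ → List ℕ → ℕ} (hJ : ∀ i ∈ Icc m M, ∀ l ∈ liveList d i, i ≤ 2 * J i l)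
    {𝒮 : ι → ℕ × ℕ × Set (Site d)} {cμ : ℝ} {c : ι → ℝ} (hc : ∀ k, 0 < c k) {γ : Fin 3 → ℚ}
    (hΓ : ∀ i, nobleFOf 𝒮 cμ c i p ≤ (γ i : ℝ)) {k : ι} (hk : 𝒮 k = (1, M + 1, {(0 : Site d)}))
    {z : ℚ} (hpz : (p : ℝ) ≤ (z : ℝ)) {I : ℕ → List ℕ → ℚ}
    (hI : ∀ i ∈ Icc m M, ∀ l ∈ liveList d i, srwI d 1 (2 * J i l) 0 ≤ (I i l : ℝ))
    {q : ℕ → ℚ} (hq : ∀ i ∈ Icc m M, wbxOrderPolicyQ d i (J i) z (γ 1) (I i) ≤ q i) :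
    (∑' y : Site d, ENNReal.ofReal (euclidNorm y ^ 2) *
        bondPercolation (zdGraph d) p (openConnGe m (0 : Site d) y □ openConn y 0)).toReal ≤
      (∑ i ∈ Icc m M, (z : ℝ) ^ i * (q i : ℝ)) + (2 * d * (z : ℝ)) ^ (M + 1) * ((γ 2 : ℝ) * c k) := by
  have hz : (0 : ℝ) ≤ z := le_trans (by exact_mod_cast unitInterval.nonneg p) hpz
  refine (toReal_tsum_sq_weighted_repBubble_le_sum_wbxOrderPolicyQ hd hp m M hJ hc hΓ hk hpz hI).trans ?_
  gcongr with i hi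
  exact hq i hi

/-! ### §3. Sanity evaluations (kernel; rational bookkeeping at toy data — not statements about percolation) -/

/-- Toy data `d = 3`, order `4`, cut `6`, `z = 1/7`, `g₁ = 1`, `I = 1/10`: the order evaluator is a rational the
kernel decides (`liveList 3 4` has `4` classes). [folklore] -/
example : wbxOrderQ 3 4 6 (1 / 7) 1 (1 / 10) = wbxOrderQ 3 4 6 (1 / 7) 1 (1 / 10) := rfl
/-- … and it is non-negative (forces the full kernel evaluation of the four class terms). [folklore] -/
example : 0 ≤ wbxOrderQ 3 4 6 (1 / 7) 1 (1 / 10) := by decide +kernel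
/-- Table-range size, `d = 10`, order `i = 6` (18 live classes), cut `L = 22`, `z = 1/17`: decided by the kernel
in about two seconds. [folklore] -/
example : 0 ≤ wbxOrderQ 10 6 22 (1 / 17) 1 (1 / 10) := by decide +kernel
/-- A policy order: `d = 3`, order `4`, per-class cuts `2·(3 + |l|)`, per-class far-node rationals. [folklore] -/
example : 0 ≤ wbxOrderPolicyQ 3 4 (fun l => 3 + l.length) (1 / 7) 1 (fun l => 1 / (10 + l.sum)) := by
  decide +kernel
/-- A chunk: the first five classes of order `9` at `d = 10`, cut `22`. [folklore] -/
example : 0 ≤ wbxClassesQ 10 9 22 (1 / 17) 1 (1 / 10) ((liveList 10 9).take 5) := by decide +kernel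

end Literature.Probability.FitznerVanDerHofstad2017
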